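import Summits.CriticalPhenomena.PercolationContinuityZ3.Theorems.PercNearOneGluingAdditiveGluingOneBond
import Summits.CriticalPhenomena.PercolationContinuityZ3.Theorems.PercNearOneGluingAdditiveGluingTieLiftOne
import Summits.CriticalPhenomena.PercolationContinuityZ3.Theorems.PercNearOneGluingNoHeavyLowerTailThreePointVarianceGladkovRegime
import HarnessLib

/-!
# The three-point rows `(3PT)` and `(3PT+)` are stable under adding an `a`–`b` edge (every finite weighted graph)

Support file for crux `stmt-CriticalPhenomena-4575` (`NoHeavyLowerTail`), seat `prim-l12-p1` gen 19
(`--supports stmt-CriticalPhenomena-4575`).  Memo `run/shared/lean/prim/prim-l12/FROM-prim-l12-p1-g19-COMB-PLUS.md` §5.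

Bond percolation `μ_w = prodBernoulli w` on the pairs of `Fin n`, three vertices `a b c`, cells `x = μ(abc)`,
`s = μ(ab|c)`, `t = μ(ac|b)`, `u = μ(bc|a)`, `q = μ(a|b|c)`, `θ = μ(a↔b) = x+s`, `γ = μ(c ↔ {a,b}) = x+t+u`.
The two rows under study are

  `(3PT)   θ(1−θ) ≤ s+t+u`      and the sharper      `(3PT+)   x(1−x) ≤ t+u+2xs`   (gen 19; `(3PT) = (3PT+) + s²`).

THIS FILE: let `e = s(a,b)`, `p = w e`, and `w₀ = w[e ↦ 0]` (the same graph with the `a`–`b` edge removed), cells of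
`w₀` written with a subscript `0`.  Then EXACTLY

* `margin⁺(w) = (1−p)²·margin⁺(w₀) + 2p(1−p)·s₀γ₀ + p²·γ₀(1−γ₀)`   (`marginPlus_abEdge`),
* `margin(w)  = (1−p)²·margin(w₀)  + 2p(1−p)·s₀   + p²·(1−γ₀)`      (`margin_abEdge`),

where `margin⁺ = t+u+2xs−x(1−x)` and `margin = s+t+u−θ(1−θ)`.  Hence both rows for `w₀` imply the rows for `w`
(`threePointPlus_of_abEdge`, `threePointVariance_of_abEdge`): in proving `(3PT)`/`(3PT+)` one may assume `a`, `b`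
non-adjacent.  (At the fibre level this is the involution "flip the colour of the `ab` edge", memo §5.)
Ingredients: the one-bond decomposition `stub_oneBondDecomp_k15`, the pushforward `tieLiftOne_real_one_eq`
(opening the pair `e`), reachability after adding one edge (`reachable_sup_edge_iff`, walk induction), and the cell
bookkeeping `ThreePointVarianceGladkovRegime.cells_eq`.
-/

namespace Summit.CriticalPhenomena.PercolationContinuityZ3.Theorems.ThreePointAbEdge

open MeasureTheory Set SimpleGraph
open Literature.Probability.Percolation Literature.Probability.LatticeModels
open Summit.CriticalPhenomena.PercolationContinuityZ3.Theorems

variable {n : ℕ}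

/-! ### Reachability after adding one edge -/

/-- **Reachability after adding the edge `uv`**: `x ~ y` in `G ⊔ uv` iff `x ~ y`, or `x ~ u` and `v ~ y`, or
`x ~ v` and `u ~ y` in `G` (a walk either avoids the new edge or crosses it). [folklore] -/
theorem reachable_sup_edge_iff {V : Type*} (G : SimpleGraph V) (u v x y : V) :
    (G ⊔ edge u v).Reachable x y ↔ G.Reachable x y ∨ (G.Reachable x u ∧ G.Reachable v y) ∨
      (G.Reachable x v ∧ G.Reachable u y) := by
  constructor
  · rintro ⟨p⟩
    induction p with
    | nil => exact Or.inl (Reachable.refl _)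
    | @cons a' b' c' hab _ ih =>
      rw [sup_adj, edge_adj] at hab
      rcases hab with hab | ⟨⟨rfl, rfl⟩ | ⟨rfl, rfl⟩, -⟩
      · rcases ih with h | ⟨h1, h2⟩ | ⟨h1, h2⟩
        · exact Or.inl (hab.reachable.trans h)
        · exact Or.inr (Or.inl ⟨hab.reachable.trans h1, h2⟩)
        · exact Or.inr (Or.inr ⟨hab.reachable.trans h1, h2⟩)
      · rcases ih with h | ⟨-, h2⟩ | ⟨-, h2⟩
        · exact Or.inr (Or.inl ⟨Reachable.refl _, h⟩)
        · exact Or.inr (Or.inl ⟨Reachable.refl _, h2⟩)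
        · exact Or.inl h2
      · rcases ih with h | ⟨-, h2⟩ | ⟨-, h2⟩
        · exact Or.inr (Or.inr ⟨Reachable.refl _, h⟩)
        · exact Or.inl h2
        · exact Or.inr (Or.inr ⟨Reachable.refl _, h2⟩)
  · have hle : G ≤ G ⊔ edge u v := le_sup_left
    rintro (h | ⟨h1, h2⟩ | ⟨h1, h2⟩)
    · exact h.mono hle
    · by_cases huv : u = v
      · subst huv; exact (h1.mono hle).trans (h2.mono hle)
      · have : (G ⊔ edge u v).Adj u v := by rw [sup_adj, edge_adj]; exact Or.inr ⟨Or.inl ⟨rfl, rfl⟩, huv⟩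
        exact ((h1.mono hle).trans this.reachable).trans (h2.mono hle)
    · by_cases huv : u = v
      · subst huv; exact (h1.mono hle).trans (h2.mono hle)
      · have : (G ⊔ edge u v).Adj v u := by
          rw [sup_adj, edge_adj]; exact Or.inr ⟨Or.inr ⟨rfl, rfl⟩, Ne.symm huv⟩
        exact ((h1.mono hle).trans this.reachable).trans (h2.mono hle)

/-- The open graph after opening the pair `s(a,b)` is the open graph with the edge `ab` added. [folklore] -/
theorem openGraph_insert (a b : Fin n) (ω : BondConfig (Fin n)) :
    openGraph (insert s(a, b) ω) = openGraph ω ⊔ edge a b := by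
  unfold openGraph edge
  rw [Set.insert_eq, fromEdgeSet_union, sup_comm]

section preimages
variable (a b c : Fin n)

/-- Opening `ab` joins `a` to `b`. [folklore] -/
theorem insert_preimage_openConn_ab :
    (fun ω : BondConfig (Fin n) => insert s(a, b) ω) ⁻¹' openConn a b = univ := by
  ext ω
  simp only [mem_preimage, openConn, mem_setOf_eq, openGraph_insert, mem_univ, iff_true]
  rw [reachable_sup_edge_iff]
  exact Or.inr (Or.inl ⟨Reachable.refl _, Reachable.refl _⟩)

/-- After opening `ab`, `c ↔ a` iff `c ↔ a` or `c ↔ b` before. [folklore] -/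
theorem insert_preimage_openConn_ac :
    (fun ω : BondConfig (Fin n) => insert s(a, b) ω) ⁻¹' openConn a c = openConn a c ∪ openConn b c := by
  ext ω
  simp only [mem_preimage, openConn, mem_setOf_eq, openGraph_insert, mem_union]
  rw [reachable_sup_edge_iff]
  constructor
  · rintro (h | ⟨-, h⟩ | ⟨h1, h2⟩)
    · exact Or.inl h
    · exact Or.inr h
    · exact Or.inl h2
  · rintro (h | h)
    · exact Or.inl h
    · exact Or.inr (Or.inl ⟨Reachable.refl _, h⟩)

/-- After opening `ab`, `c ↔ b` iff `c ↔ a` or `c ↔ b` before. [folklore] -/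
theorem insert_preimage_openConn_bc :
    (fun ω : BondConfig (Fin n) => insert s(a, b) ω) ⁻¹' openConn b c = openConn a c ∪ openConn b c := by
  ext ω
  simp only [mem_preimage, openConn, mem_setOf_eq, openGraph_insert, mem_union]
  rw [reachable_sup_edge_iff]
  constructor
  · rintro (h | ⟨-, h2⟩ | ⟨-, h⟩)
    · exact Or.inr h
    · exact Or.inr h2
    · exact Or.inl h
  · rintro (h | h)
    · exact Or.inr (Or.inr ⟨Reachable.refl _, h⟩)
    · exact Or.inl h

end preimages

/-! ### Probabilities after opening / under the weight of the pair `ab` -/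

/-- The four connection probabilities of `w` in terms of those of `w₀ = w[ab ↦ 0]`:
with `p = w(ab)` and `γ₀ = μ₀(ac ∪ bc)`,  `μ(ab) = (1−p)μ₀(ab) + p`, `μ(ac) = (1−p)μ₀(ac) + pγ₀`,
`μ(bc) = (1−p)μ₀(bc) + pγ₀`, `μ(ab ∩ ac) = (1−p)μ₀(ab ∩ ac) + pγ₀`. [this work] -/
theorem probs_abEdge (w : Sym2 (Fin n) → unitInterval) (a b c : Fin n) :
    let e := s(a, b)
    let μ := prodBernoulli w
    let μ₀ := prodBernoulli (Function.update w e 0)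
    let p : ℝ := (w e : ℝ)
    μ.real (openConn a b) = (1 - p) * μ₀.real (openConn a b) + p ∧
    μ.real (openConn a c) = (1 - p) * μ₀.real (openConn a c) + p * μ₀.real (openConn a c ∪ openConn b c) ∧
    μ.real (openConn b c) = (1 - p) * μ₀.real (openConn b c) + p * μ₀.real (openConn a c ∪ openConn b c) ∧
    μ.real (openConn a b ∩ openConn a c) =
      (1 - p) * μ₀.real (openConn a b ∩ openConn a c) + p * μ₀.real (openConn a c ∪ openConn b c) := by
  intro e μ μ₀ p
  have dec := fun S => stub_oneBondDecomp_k15 n w e S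
  have op := fun S => tieLiftOne_real_one_eq w e S
  refine ⟨?_, ?_, ?_, ?_⟩
  · rw [dec, op]
    change (1 - p) * μ₀.real (openConn a b) + p * μ₀.real ((fun ω : BondConfig (Fin n) => insert s(a, b) ω) ⁻¹' openConn a b) = _
    rw [insert_preimage_openConn_ab, probReal_univ, mul_one]
  · rw [dec, op]
    change (1 - p) * μ₀.real (openConn a c) + p * μ₀.real ((fun ω : BondConfig (Fin n) => insert s(a, b) ω) ⁻¹' openConn a c) = _
    rw [insert_preimage_openConn_ac]
  · rw [dec, op]
    change (1 - p) * μ₀.real (openConn b c) + p * μ₀.real ((fun ω : BondConfig (Fin n) => insert s(a, b) ω) ⁻¹' openConn b c) = _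
    rw [insert_preimage_openConn_bc]
  · rw [dec, op]
    change (1 - p) * μ₀.real (openConn a b ∩ openConn a c) +
      p * μ₀.real ((fun ω : BondConfig (Fin n) => insert s(a, b) ω) ⁻¹' (openConn a b ∩ openConn a c)) = _
    rw [Set.preimage_inter, insert_preimage_openConn_ab, insert_preimage_openConn_ac, Set.univ_inter]

/-! ### The margin identities -/

/-- `μ₀(ac ∪ bc) = μ₀(ac) + μ₀(bc) − μ₀(ab ∩ ac)` (the intersection `ac ∩ bc` is the event `abc`). [folklore] -/
theorem real_union_ac_bc (w : Sym2 (Fin n) → unitInterval) (a b c : Fin n) :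
    (prodBernoulli w).real (openConn a c ∪ openConn b c) =
      (prodBernoulli w).real (openConn a c) + (prodBernoulli w).real (openConn b c) -
        (prodBernoulli w).real (openConn a b ∩ openConn a c) := by
  have hc := ThreePointVarianceGladkovRegime.cells_eq w a b c
  have h := measureReal_union_add_inter (μ := prodBernoulli w) (s := openConn a c) (t := openConn b c)
    MeasurableSet.of_discrete
  rw [hc.2.1] at h
  linarith

/-- **`(3PT+)` margin identity under the `ab` edge.**  With `μ = μ_w`, `μ₀ = μ_{w[ab↦0]}`, `p = w(ab)`,
`x = μ(ab ∩ ac)`, `P_{xy} = μ(x ↔ y)`, `margin⁺ := (P_ac − x) + (P_bc − x) + 2x(P_ab − x) − x(1 − x)` and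
`γ₀ = P⁰_ac + P⁰_bc − x₀`, `s₀ = P⁰_ab − x₀`:
`margin⁺(w) = (1−p)² margin⁺(w₀) + 2p(1−p) s₀ γ₀ + p² γ₀ (1 − γ₀)`. [this work] -/
theorem marginPlus_abEdge (w : Sym2 (Fin n) → unitInterval) (a b c : Fin n) :
    let μ := prodBernoulli w
    let μ₀ := prodBernoulli (Function.update w s(a, b) 0)
    let p : ℝ := (w s(a, b) : ℝ)
    let x := μ.real (openConn a b ∩ openConn a c)
    let x₀ := μ₀.real (openConn a b ∩ openConn a c)
    let γ₀ := μ₀.real (openConn a c) + μ₀.real (openConn b c) - x₀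
    let s₀ := μ₀.real (openConn a b) - x₀
    (μ.real (openConn a c) - x) + (μ.real (openConn b c) - x) + 2 * x * (μ.real (openConn a b) - x) - x * (1 - x) =
      (1 - p) ^ 2 * ((μ₀.real (openConn a c) - x₀) + (μ₀.real (openConn b c) - x₀) +
          2 * x₀ * (μ₀.real (openConn a b) - x₀) - x₀ * (1 - x₀)) +
        2 * p * (1 - p) * s₀ * γ₀ + p ^ 2 * γ₀ * (1 - γ₀) := by
  intro μ μ₀ p x x₀ γ₀ s₀
  obtain ⟨h1, h2, h3, h4⟩ := probs_abEdge w a b c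
  have hu := real_union_ac_bc (Function.update w s(a, b) 0) a b c
  simp only [μ, x, x₀, γ₀, s₀, μ₀, p] at *
  rw [h1, h2, h3, h4, hu]
  ring

/-- **`(3PT)` margin identity under the `ab` edge**: with `margin := (P_ab − x) + (P_ac − x) + (P_bc − x) − P_ab(1 − P_ab)`,
`margin(w) = (1−p)² margin(w₀) + 2p(1−p) s₀ + p²(1 − γ₀)`. [this work] -/
theorem margin_abEdge (w : Sym2 (Fin n) → unitInterval) (a b c : Fin n) :
    let μ := prodBernoulli w
    let μ₀ := prodBernoulli (Function.update w s(a, b) 0)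
    let p : ℝ := (w s(a, b) : ℝ)
    let x := μ.real (openConn a b ∩ openConn a c)
    let x₀ := μ₀.real (openConn a b ∩ openConn a c)
    let γ₀ := μ₀.real (openConn a c) + μ₀.real (openConn b c) - x₀
    let s₀ := μ₀.real (openConn a b) - x₀
    (μ.real (openConn a b) - x) + (μ.real (openConn a c) - x) + (μ.real (openConn b c) - x) -
        μ.real (openConn a b) * (1 - μ.real (openConn a b)) =
      (1 - p) ^ 2 * ((μ₀.real (openConn a b) - x₀) + (μ₀.real (openConn a c) - x₀) + (μ₀.real (openConn b c) - x₀) -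
          μ₀.real (openConn a b) * (1 - μ₀.real (openConn a b))) +
        2 * p * (1 - p) * s₀ + p ^ 2 * (1 - γ₀) := by
  intro μ μ₀ p x x₀ γ₀ s₀
  obtain ⟨h1, h2, h3, h4⟩ := probs_abEdge w a b c
  have hu := real_union_ac_bc (Function.update w s(a, b) 0) a b c
  simp only [μ, x, x₀, γ₀, s₀, μ₀, p] at *
  rw [h1, h2, h3, h4, hu]
  ring

/-! ### The two rows are inherited from the graph without the `ab` edge -/

/-- **`(3PT+)` is stable under adding an `a`–`b` edge** (any weight): if
`μ₀(abc)·μ₀(¬abc) ≤ μ₀(ac|b) + μ₀(bc|a) + 2μ₀(abc)μ₀(ab|c)` for `w₀ = w[ab ↦ 0]`, then the same holds for `w`. [this work] -/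
theorem threePointPlus_of_abEdge (w : Sym2 (Fin n) → unitInterval) (a b c : Fin n)
    (h₀ : (prodBernoulli (Function.update w s(a, b) 0)).real (openConn a b ∩ openConn a c) *
        (prodBernoulli (Function.update w s(a, b) 0)).real (openConn a b ∩ openConn a c)ᶜ ≤
      (prodBernoulli (Function.update w s(a, b) 0)).real (openConn a c ∩ (openConn a b)ᶜ) +
        (prodBernoulli (Function.update w s(a, b) 0)).real (openConn b c ∩ (openConn a b)ᶜ) +
          2 * (prodBernoulli (Function.update w s(a, b) 0)).real (openConn a b ∩ openConn a c) *
            (prodBernoulli (Function.update w s(a, b) 0)).real (openConn a b ∩ (openConn a c)ᶜ)) :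
    (prodBernoulli w).real (openConn a b ∩ openConn a c) * (prodBernoulli w).real (openConn a b ∩ openConn a c)ᶜ ≤
      (prodBernoulli w).real (openConn a c ∩ (openConn a b)ᶜ) + (prodBernoulli w).real (openConn b c ∩ (openConn a b)ᶜ) +
        2 * (prodBernoulli w).real (openConn a b ∩ openConn a c) *
          (prodBernoulli w).real (openConn a b ∩ (openConn a c)ᶜ) := by
  set μ := prodBernoulli w with hμ
  set μ₀ := prodBernoulli (Function.update w s(a, b) 0) with hμ₀
  have hid := marginPlus_abEdge w a b c
  have hc := ThreePointVarianceGladkovRegime.cells_eq w a b c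
  have hc₀ := ThreePointVarianceGladkovRegime.cells_eq (Function.update w s(a, b) 0) a b c
  simp only [← hμ, ← hμ₀] at hid hc hc₀
  obtain ⟨-, -, -, e4, e5, e6, -⟩ := hc
  obtain ⟨-, f2, -, f4, f5, f6, -⟩ := hc₀
  have ecT : μ.real (openConn a b ∩ openConn a c)ᶜ = 1 - μ.real (openConn a b ∩ openConn a c) :=
    by rw [measureReal_compl MeasurableSet.of_discrete, probReal_univ]
  have ecT₀ : μ₀.real (openConn a b ∩ openConn a c)ᶜ = 1 - μ₀.real (openConn a b ∩ openConn a c) :=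
    by rw [measureReal_compl MeasurableSet.of_discrete, probReal_univ]
  rw [ecT, e4, e5, e6]
  rw [ecT₀, f4, f5, f6] at h₀
  -- sign information for the correction terms
  have hp0 : 0 ≤ (w s(a, b) : ℝ) := (w s(a, b)).2.1
  have hp1 : (w s(a, b) : ℝ) ≤ 1 := (w s(a, b)).2.2
  have hs₀ : 0 ≤ μ₀.real (openConn a b) - μ₀.real (openConn a b ∩ openConn a c) := by
    rw [← f4]; exact measureReal_nonneg
  have hγ₀ : 0 ≤ μ₀.real (openConn a c) + μ₀.real (openConn b c) - μ₀.real (openConn a b ∩ openConn a c) := by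
    rw [← real_union_ac_bc]; exact measureReal_nonneg
  have hγ₁ : μ₀.real (openConn a c) + μ₀.real (openConn b c) - μ₀.real (openConn a b ∩ openConn a c) ≤ 1 := by
    rw [← real_union_ac_bc]; exact measureReal_le_one
  nlinarith [hid, h₀, mul_nonneg hs₀ hγ₀, mul_nonneg hγ₀ (sub_nonneg.2 hγ₁), mul_nonneg hp0 (sub_nonneg.2 hp1),
    sq_nonneg (1 - (w s(a, b) : ℝ)), sq_nonneg (w s(a, b) : ℝ),
    mul_nonneg (mul_nonneg hp0 (sub_nonneg.2 hp1)) (mul_nonneg hs₀ hγ₀),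
    mul_nonneg (sq_nonneg (w s(a, b) : ℝ)) (mul_nonneg hγ₀ (sub_nonneg.2 hγ₁))]

/-- **`(3PT)` is stable under adding an `a`–`b` edge** (any weight): if
`μ₀(a↔b)μ₀(a↮b) ≤ μ₀(ab|c) + μ₀(ac|b) + μ₀(bc|a)` for `w₀ = w[ab ↦ 0]`, then the same holds for `w`. [this work] -/
theorem threePointVariance_of_abEdge (w : Sym2 (Fin n) → unitInterval) (a b c : Fin n)
    (h₀ : (prodBernoulli (Function.update w s(a, b) 0)).real (openConn a b) *
        (prodBernoulli (Function.update w s(a, b) 0)).real (openConn a b)ᶜ ≤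
      (prodBernoulli (Function.update w s(a, b) 0)).real (openConn a b ∩ (openConn a c)ᶜ) +
        (prodBernoulli (Function.update w s(a, b) 0)).real (openConn a c ∩ (openConn a b)ᶜ) +
          (prodBernoulli (Function.update w s(a, b) 0)).real (openConn b c ∩ (openConn a b)ᶜ)) :
    (prodBernoulli w).real (openConn a b) * (prodBernoulli w).real (openConn a b)ᶜ ≤
      (prodBernoulli w).real (openConn a b ∩ (openConn a c)ᶜ) + (prodBernoulli w).real (openConn a c ∩ (openConn a b)ᶜ) +
        (prodBernoulli w).real (openConn b c ∩ (openConn a b)ᶜ) := by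
  set μ := prodBernoulli w with hμ
  set μ₀ := prodBernoulli (Function.update w s(a, b) 0) with hμ₀
  have hid := margin_abEdge w a b c
  have hc := ThreePointVarianceGladkovRegime.cells_eq w a b c
  have hc₀ := ThreePointVarianceGladkovRegime.cells_eq (Function.update w s(a, b) 0) a b c
  simp only [← hμ, ← hμ₀] at hid hc hc₀
  obtain ⟨-, -, e3, e4, e5, e6, -⟩ := hc
  obtain ⟨-, -, f3, f4, f5, f6, -⟩ := hc₀
  rw [e3, e4, e5, e6]
  rw [f3, f4, f5, f6] at h₀
  have hp0 : 0 ≤ (w s(a, b) : ℝ) := (w s(a, b)).2.1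
  have hp1 : (w s(a, b) : ℝ) ≤ 1 := (w s(a, b)).2.2
  have hs₀ : 0 ≤ μ₀.real (openConn a b) - μ₀.real (openConn a b ∩ openConn a c) := by
    rw [← f4]; exact measureReal_nonneg
  have hγ₁ : μ₀.real (openConn a c) + μ₀.real (openConn b c) - μ₀.real (openConn a b ∩ openConn a c) ≤ 1 := by
    rw [← real_union_ac_bc]; exact measureReal_le_one
  nlinarith [hid, h₀, mul_nonneg hp0 (sub_nonneg.2 hp1), sq_nonneg (1 - (w s(a, b) : ℝ)), sq_nonneg (w s(a, b) : ℝ),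
    mul_nonneg (mul_nonneg hp0 (sub_nonneg.2 hp1)) hs₀,
    mul_nonneg (sq_nonneg (w s(a, b) : ℝ)) (sub_nonneg.2 hγ₁)]

end Summit.CriticalPhenomena.PercolationContinuityZ3.Theorems.ThreePointAbEdge
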